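/-
Copyright: the b2b-balaban cell (near-miss cell 7), T⁴-continuum CRUX team (coordinator ruling e34b3e0c item (2)),
seat t4-ne7b-formalise-leaf-01 (gen 28). Released under the licence of the surrounding project.
-/
import Summits.QuantumFields.BalabanUV.T4Continuum.Spine.NE7b.NonAbelianStokesBound

/-!
# (NAS) the lattice non-abelian Stokes INEQUALITY, part 3: general discs as scripts of the two moves
# (route NE7b R-H ∕ C-RH°, `t4/ROUTES-NE7b.md` v7 §1 (NAS) «induct on #D»; PRICING-NE7b v8 F38 (a) «the disc→lasso
# presentation of the boundary word is the only topological datum»)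

Cell `pub-balaban`, sub-cell `t4`, spine estimate NE7b (node U5c), candidate route R-H. Part 1 (`NonAbelianStokesBound`,
p258024) proved the two MOVES of v7's disc induction — backtrack cancellation `hol_backtrack` and the gluing lemma
`dist1_hol_glue_le : disp σ = 0 → dist1 V(ασβ) ≤ dist1 V(σ) + dist1 V(αβ)` — and (NAS) for rectangles; part 2
(`NonAbelianStokesReading`, p258437) gave the `Sweep1`∕`S³` readings and (FF). THIS FILE closes the general statement.

A **script** is a list of moves — «insert the backtrack `l · l⁻¹` at position `n`» ∕ «insert the word `σ` at position `n`»
— applied in order from the empty word (`build`); `loops ms` lists the inserted words, `glued x ms` the same words with the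
base points at which they are read inside the built word. DATA ONLY: `Move` is a type, `build`∕`loops`∕`glued` are
functions (no `Prop`-valued definition). For a script whose inserted words are closed, **(NAS) for built words**:
`dist1 V(build ms; x) ≤ Σ_{(y,σ) ∈ glued x ms} dist1 V(σ; y)` (`dist1_hol_build_le_sum`, induction on the script with the two
moves); with plaquette contours (either orientation) as the inserted words this is v7's `|hol(∂D) − 1| ≤ Σ_{p∈D} |U_p − 1|`
verbatim for every disc `D` PRESENTED BY A SCRIPT (`dist1_hol_build_le_sum_plaquettes`). Writing the script of a given disc
shape — the non-abelian Stokes THEOREM's combinatorial half — is list bookkeeping left to the user of a shape (the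
coordinate rectangle was done directly in part 1 by the stack-of-ladders recursion).

HONEST FRAMING. Law-free algebra about ONE lattice configuration; no measure, no effective action, no constant of
[Bałaban 1983–89] asserted or cited; nothing of bill A∕B, (MP<L²), (JC), (TC). NE7b (`T4WeightBudget.RelWeightBound`) NOT
PRINTED, NOT PROVED; spine PROVED 0∕9; rung (B)+1 on a FINITE torus T⁴ — NOT infinite volume, NOT the mass gap, NOT Clay.
HONEST DEPENDENCY: continuum YM on T⁴ ⇐ BetaPertH ∧ nine spine estimates (0/9 proved); BetaPertH ⇐ (D1) ∧ (D4) ∧ CAP+tail;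
G-an2-4 gates asym, D1 and NE2/3/4. POLICY: crux-route work under `Spine/NE7b/` (ROUTES v7 §6's named item (NAS);
coordinator FREEZE (0) respected: not a `T4Continuum/Support` leaf); concrete data definitions only, no `[cite:]`.
-/

set_option autoImplicit false

namespace Summit.QuantumFields.BalabanUV.T4Continuum.NE7b.NonAbelianStokesDisc

noncomputable section

open Literature.MathematicalPhysics.QuantumFieldTheory.Balaban1983to89 (GaugeGroup dist1)
open Literature.MathematicalPhysics.QuantumFieldTheory.Balaban1983to89.B7Prop1Explicit
  (Letter disp disp_append disp_revWord revWord hol hol_revWord' plaqWord disp_plaqWord)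
open Summit.QuantumFields.BalabanUV.T4Continuum.NE7b.NonAbelianStokesBound (hol_backtrack dist1_hol_glue_le)

section Scripts

variable {d : ℕ} {G : Type*}

/-- A MOVE of a disc script: insert a backtrack `l · l⁻¹` at position `n`; CANCEL the backtrack `l · l⁻¹` standing at
position `n` (no-op if it is not there); or insert the word `σ` at position `n` (v7: «replace `αβ` by `ασβ` … backtracks
cancel»). -/
inductive Move (d : ℕ) : Type
  | backtrack (n : ℕ) (l : Letter d)
  | cancel (n : ℕ) (l : Letter d)
  | loop (n : ℕ) (σ : List (Letter d))

/-- Applying a move to a word (positions count letters of the current word; `List.take n w` is the prefix kept). -/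
def Move.apply : Move d → List (Letter d) → List (Letter d)
  | Move.backtrack n l, w => w.take n ++ l :: l.rev :: w.drop n
  | Move.cancel n l, w => if (w.drop n).take 2 = [l, l.rev] then w.take n ++ w.drop (n + 2) else w
  | Move.loop n σ, w => w.take n ++ σ ++ w.drop n

/-- The word BUILT by a script (moves applied in order, head of the list LAST), starting from the empty word. -/
def build : List (Move d) → List (Letter d)
  | [] => []
  | m :: ms => m.apply (build ms)

/-- The words inserted by the loop moves of a script. -/
def loops : List (Move d) → List (List (Letter d))
  | [] => []
  | Move.backtrack _ _ :: ms => loops ms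
  | Move.cancel _ _ :: ms => loops ms
  | Move.loop _ σ :: ms => σ :: loops ms

/-- The inserted words, each with the base point `x + disp (prefix)` at which it is read inside the built word. -/
def glued (x : Fin d → ℤ) : List (Move d) → List ((Fin d → ℤ) × List (Letter d))
  | [] => []
  | Move.backtrack _ _ :: ms => glued x ms
  | Move.cancel _ _ :: ms => glued x ms
  | Move.loop n σ :: ms => (x + disp ((build ms).take n), σ) :: glued x ms

/-- `build` after a backtrack move. -/
@[simp] theorem build_backtrack (n : ℕ) (l : Letter d) (ms : List (Move d)) :
    build (Move.backtrack n l :: ms) = (build ms).take n ++ l :: l.rev :: (build ms).drop n := rfl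

/-- `build` after a loop move. -/
@[simp] theorem build_loop (n : ℕ) (σ : List (Letter d)) (ms : List (Move d)) :
    build (Move.loop n σ :: ms) = (build ms).take n ++ σ ++ (build ms).drop n := rfl

/-- `build` after a cancel move. -/
theorem build_cancel (n : ℕ) (l : Letter d) (ms : List (Move d)) :
    build (Move.cancel n l :: ms) =
      if ((build ms).drop n).take 2 = [l, l.rev] then (build ms).take n ++ (build ms).drop (n + 2) else build ms := rfl

/-- When the cancel move fires, the word WAS `prefix · l · l⁻¹ · suffix`. -/
theorem eq_backtrack_of_take_two {w : List (Letter d)} {n : ℕ} {l : Letter d} (h : (w.drop n).take 2 = [l, l.rev]) :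
    w = w.take n ++ l :: l.rev :: w.drop (n + 2) := by
  have h1 : w.drop n = l :: l.rev :: w.drop (n + 2) := by
    rw [← List.take_append_drop 2 (w.drop n), h, List.drop_drop]
    rfl
  conv_lhs => rw [← List.take_append_drop n w, h1]

/-- A word built by inserting closed words (and backtracks) is closed. -/
theorem disp_build : ∀ ms : List (Move d), (∀ σ ∈ loops ms, disp σ = 0) → disp (build ms) = 0
  | [], _ => by simp [build]
  | Move.backtrack n l :: ms, h => by
    have ih := disp_build ms fun σ hσ => h σ (by simpa [loops] using hσ)
    rw [← List.take_append_drop n (build ms), disp_append] at ih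
    simpa using ih
  | Move.cancel n l :: ms, h => by
    have ih := disp_build ms fun σ hσ => h σ (by simpa [loops] using hσ)
    rw [build_cancel]
    split_ifs with hc
    · rw [eq_backtrack_of_take_two hc] at ih
      simpa using ih
    · exact ih
  | Move.loop n σ :: ms, h => by
    have ih := disp_build ms fun τ hτ => h τ (by simp [loops, hτ])
    rw [← List.take_append_drop n (build ms), disp_append] at ih
    simp only [build_loop, disp_append, h σ (by simp [loops]), add_zero]
    exact ih

variable [GaugeGroup G] (V : (Fin d → ℤ) → Fin d → G)

/-- A closed word read backwards has the same size: `dist1 V(σ⁻¹) = dist1 V(σ)` for `disp σ = 0`. -/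
theorem dist1_hol_revWord_of_closed (y : Fin d → ℤ) (σ : List (Letter d)) (hσ : disp σ = 0) :
    dist1 (hol V y (revWord σ)) = dist1 (hol V y σ) := by
  rw [hol_revWord' V y σ (by rw [hσ, add_zero]), GaugeGroup.dist1_inv]

/-- **(NAS) FOR BUILT WORDS**: for a script `ms` whose inserted words are closed,
`dist1 V(build ms; x) ≤ Σ_{(y,σ) ∈ glued x ms} dist1 V(σ; y)` — induction on the script with `hol_backtrack` and the gluing
lemma `dist1_hol_glue_le` (`take n w ++ drop n w = w`). -/
theorem dist1_hol_build_le_sum (x : Fin d → ℤ) :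
    ∀ ms : List (Move d), (∀ σ ∈ loops ms, disp σ = 0) →
      dist1 (hol V x (build ms)) ≤ ((glued x ms).map fun q => dist1 (hol V q.1 q.2)).sum
  | [], _ => by simp [build, glued, GaugeGroup.dist1_one]
  | Move.backtrack n l :: ms, h => by
    have ih := dist1_hol_build_le_sum x ms fun σ hσ => h σ (by simpa [loops] using hσ)
    rw [← List.take_append_drop n (build ms)] at ih
    rw [build_backtrack, hol_backtrack]
    exact ih
  | Move.cancel n l :: ms, h => by
    have ih := dist1_hol_build_le_sum x ms fun σ hσ => h σ (by simpa [loops] using hσ)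
    rw [build_cancel, glued]
    split_ifs with hc
    · rw [eq_backtrack_of_take_two hc, hol_backtrack] at ih
      exact ih
    · exact ih
  | Move.loop n σ :: ms, h => by
    have ih := dist1_hol_build_le_sum x ms fun τ hτ => h τ (by simp [loops, hτ])
    rw [← List.take_append_drop n (build ms)] at ih
    rw [build_loop, glued, List.map_cons, List.sum_cons]
    exact (dist1_hol_glue_le V x _ σ _ (h σ (by simp [loops]))).trans (add_le_add le_rfl ih)

/-- **(NAS) FOR DISCS OF PLAQUETTES, v7's form**: if every word inserted by the script is a plaquette contour `plaqWord κ μ`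
or its reverse (orientation free), then `dist1 V(build ms) ≤ Σ dist1 V(∂pᵢ)` — `|hol(∂D) − 1| ≤ Σ_{p∈D} |U_p − 1|` for
every disc `D` presented by a script. -/
theorem dist1_hol_build_le_sum_plaquettes (x : Fin d → ℤ) (ms : List (Move d))
    (pl : ((Fin d → ℤ) × List (Letter d)) → Fin d × Fin d)
    (hpl : ∀ q ∈ glued x ms, q.2 = plaqWord (pl q).1 (pl q).2 ∨ q.2 = revWord (plaqWord (pl q).1 (pl q).2)) :
    dist1 (hol V x (build ms)) ≤ ((glued x ms).map fun q => dist1 (hol V q.1 (plaqWord (pl q).1 (pl q).2))).sum := by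
  have hmem : ∀ ms : List (Move d), ∀ σ ∈ loops ms, ∃ y, (y, σ) ∈ glued x ms := by
    intro ms
    induction ms with
    | nil => simp [loops]
    | cons m ms ih =>
      cases m with
      | backtrack n l => simpa [loops, glued] using ih
      | cancel n l => simpa [loops, glued] using ih
      | loop n τ =>
        intro σ hσ
        rcases List.mem_cons.mp (by simpa [loops] using hσ) with rfl | hσ'
        · exact ⟨x + disp ((build ms).take n), by simp [glued]⟩
        · obtain ⟨y, hy⟩ := ih σ hσ'
          exact ⟨y, by simp [glued, hy]⟩
  have hcl : ∀ σ ∈ loops ms, disp σ = 0 := by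
    intro σ hσ
    obtain ⟨y, hy⟩ := hmem ms σ hσ
    rcases hpl (y, σ) hy with h | h
    · simp only at h; rw [h, disp_plaqWord]
    · simp only at h; rw [h, disp_revWord, disp_plaqWord, neg_zero]
  refine (dist1_hol_build_le_sum V x ms hcl).trans (le_of_eq ?_)
  refine congrArg List.sum (List.map_congr_left fun q hq => ?_)
  rcases hpl q hq with hq' | hq'
  · rw [hq']
  · rw [hq', dist1_hol_revWord_of_closed V q.1 _ (disp_plaqWord _ _)]

/-- **SANITY — v7's induction step on the smallest non-trivial disc.** The `2 × 1` rectangle in the `(κ, μ)`-plane based at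
`x`: glue `∂p₁ = plaqWord κ μ` into the empty word, glue `∂p₂` (the plaquette at `x + e_κ`) after the first letter, and
cancel the backtrack `μ⁻¹ · μ` this creates — the built word IS `rectWord κ μ 2 1` of part 1. -/
theorem build_rect21 (κ μ : Fin d) :
    build [Move.cancel 4 (μ, false), Move.loop 1 (plaqWord κ μ), Move.loop 0 (plaqWord κ μ)] =
      NonAbelianStokesBound.rectWord κ μ 2 1 := by
  simp [build, Move.apply, plaqWord, NonAbelianStokesBound.rectWord, revWord, Letter.rev, List.take, List.drop]
  rfl

/-- … hence (NAS) for it from the general theorem: `dist1 V(∂R_{2,1}) ≤ dist1 V(∂p(x + e_κ)) + dist1 V(∂p(x))`. -/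
example (x : Fin d → ℤ) (κ μ : Fin d) :
    dist1 (hol V x (NonAbelianStokesBound.rectWord κ μ 2 1)) ≤
      dist1 (hol V (x + disp [((κ, true) : Letter d)]) (plaqWord κ μ)) + (dist1 (hol V (x + disp ([] : List (Letter d))) (plaqWord κ μ)) + 0) := by
  have h := dist1_hol_build_le_sum V x [Move.cancel 4 (μ, false), Move.loop 1 (plaqWord κ μ), Move.loop 0 (plaqWord κ μ)]
    (by simp [loops, disp_plaqWord])
  rw [build_rect21] at h
  simpa [glued, build, Move.apply, plaqWord, List.take] using h

end Scripts

end

end Summit.QuantumFields.BalabanUV.T4Continuum.NE7b.NonAbelianStokesDisc
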